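import Mathlib
import Summits.KontsevichZagierPeriods.Zeta5Search.CatalanTwoAdicRay
import Summits.KontsevichZagierPeriods.Zeta5Search.CatalanEnclosure
import HarnessLib

/-!
# The 2-adic ray chain, II: automatic growth of the `P`-part and window multipliers
HONEST FRAMING: systematic search; no irrationality claim unless certified.  Sequel to `CatalanTwoAdicRay.lean`
(pub-zeta5 fam-catalan, TWOADIC.md §11–§12): (1) `abs_Jsym_ray_le_one` (|J_n| ≤ 1 on the rays, proved on Viola's
`Jsym` as typed) ⇒ `rayGrowth_of_explicit_growth`, `ray_measure_explicit`; (2) `window_measure` = `ray_measure` for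
ANY odd clearing sequence `D_n · 2^{2Wn}` (fam-denom K7 windows: exponents 9.51 / 9.34 / 8.69 / 8.29 on rays
8 / 10 / 12 / 16 — all weaker than the 7.1774 extractable from Calegari 2005 / Beukers 2008; ζ₂(2) ∉ ℚ is KNOWN). -/

namespace Summit.KontsevichZagierPeriods.Zeta5Search.CatalanTwoAdicSeries

open Real Finset
open Literature.NumberTheory.Irrationality.Nesterenko2016 (Jsym)
open Literature.NumberTheory.Transcendental (catalanConstant)
open Summit.KontsevichZagierPeriods.Zeta5Search.CatalanQSum (catalanQ)
open Summit.KontsevichZagierPeriods.Zeta5Search.PadicIrrationality (measure_of_two_sided_forms)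

section Growth

open MeasureTheory Set
open Summit.KontsevichZagierPeriods.Zeta5Search.Zudilin2003Growth (catalanConstant_lt catalanConstant_pos)

/-- On the rays `(n, jn, n, (j+1)n, n)` with `n ≥ 2`, Viola's integrand is bounded by `1` in absolute value on `(0,1)²`. -/
theorem ray_integrand_abs_le_one (j n : ℕ) (hn : 2 ≤ n) {x y : ℝ} (hx : x ∈ Ioo (0 : ℝ) 1)
    (hy : y ∈ Ioo (0 : ℝ) 1) :
    ‖x ^ n * (1 - x) ^ (j * n) * y ^ ((j + 1) * n) * (1 - y) ^ n
        / (1 - x * y) ^ (((j * n : ℕ) : ℤ) + ((n : ℕ) : ℤ) - ((n : ℕ) : ℤ))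
        / (Real.sqrt x * Real.sqrt (1 - y) * (1 - x * y))‖ ≤ 1 := by
  obtain ⟨hx0, hx1⟩ := hx
  obtain ⟨hy0, hy1⟩ := hy
  have h1x : 0 < 1 - x := by linarith
  have h1y : 0 < 1 - y := by linarith
  have hxy : 0 < 1 - x * y := by nlinarith
  have hsx : 0 < Real.sqrt x := Real.sqrt_pos.mpr hx0
  have hsy : 0 < Real.sqrt (1 - y) := Real.sqrt_pos.mpr h1y
  have he : ((j * n : ℕ) : ℤ) + ((n : ℕ) : ℤ) - ((n : ℕ) : ℤ) = ((j * n : ℕ) : ℤ) := by ring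
  rw [he, zpow_natCast]
  set F := x ^ n * (1 - x) ^ (j * n) * y ^ ((j + 1) * n) * (1 - y) ^ n / (1 - x * y) ^ (j * n)
        / (Real.sqrt x * Real.sqrt (1 - y) * (1 - x * y)) with hF
  have hF' : F = (x ^ n / Real.sqrt x) * ((1 - x) ^ (j * n) / (1 - x * y) ^ (j * n)) * y ^ ((j + 1) * n)
        * ((1 - y) ^ n / (Real.sqrt (1 - y) * (1 - x * y))) := by
    rw [hF]; field_simp
  have hF0 : 0 ≤ F := by
    rw [hF']
    have : 0 ≤ (1 - x) ^ (j * n) / (1 - x * y) ^ (j * n) := div_nonneg (pow_nonneg h1x.le _) (pow_nonneg hxy.le _)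
    have : 0 ≤ (1 - y) ^ n / (Real.sqrt (1 - y) * (1 - x * y)) :=
      div_nonneg (pow_nonneg h1y.le _) (mul_nonneg hsy.le hxy.le)
    positivity
  -- factor bounds
  have hx_sqrt : x ≤ Real.sqrt x := by
    conv_lhs => rw [← Real.sqrt_sq hx0.le]
    exact Real.sqrt_le_sqrt (by nlinarith)
  have hA : x ^ n / Real.sqrt x ≤ 1 := by
    rw [div_le_one hsx]
    exact (pow_le_of_le_one hx0.le hx1.le (by omega)).trans hx_sqrt
  have hB : (1 - x) ^ (j * n) / (1 - x * y) ^ (j * n) ≤ 1 := by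
    rw [div_le_one (pow_pos hxy _)]
    exact pow_le_pow_left₀ h1x.le (by nlinarith) _
  have hB0 : 0 ≤ (1 - x) ^ (j * n) / (1 - x * y) ^ (j * n) := div_nonneg (pow_nonneg h1x.le _) (pow_nonneg hxy.le _)
  have hC : y ^ ((j + 1) * n) ≤ 1 := pow_le_one₀ hy0.le hy1.le
  have hC0 : 0 ≤ y ^ ((j + 1) * n) := pow_nonneg hy0.le _
  have hy_sqrt : 1 - y ≤ Real.sqrt (1 - y) := by
    conv_lhs => rw [← Real.sqrt_sq h1y.le]
    exact Real.sqrt_le_sqrt (by nlinarith)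
  have hD : (1 - y) ^ n / (Real.sqrt (1 - y) * (1 - x * y)) ≤ 1 := by
    rw [div_le_one (mul_pos hsy hxy)]
    calc (1 - y) ^ n ≤ (1 - y) ^ 2 := pow_le_pow_of_le_one h1y.le (by linarith) hn
      _ = (1 - y) * (1 - y) := by ring
      _ ≤ Real.sqrt (1 - y) * (1 - x * y) :=
          mul_le_mul hy_sqrt (by nlinarith) h1y.le (Real.sqrt_nonneg _)
  have hD0 : 0 ≤ (1 - y) ^ n / (Real.sqrt (1 - y) * (1 - x * y)) :=
    div_nonneg (pow_nonneg h1y.le _) (mul_nonneg hsy.le hxy.le)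
  have hF1 : F ≤ 1 := by
    rw [hF']
    exact mul_le_one₀ (mul_le_one₀ (mul_le_one₀ hA hB0 hB) hC0 hC) hD0 hD
  rw [Real.norm_eq_abs, abs_le]
  exact ⟨by linarith, hF1⟩

/-- `|J_n| ≤ 1` along the rays (`n ≥ 2`), for Viola's `Jsym` as typed (iterated set integrals; holds even for junk values,
since only the pointwise bound and the finiteness of the measure are used). -/
theorem abs_Jsym_ray_le_one (j n : ℕ) (hn : 2 ≤ n) : |Jsym n (j * n) n ((j + 1) * n) n| ≤ 1 := by
  rw [← Real.norm_eq_abs]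
  unfold Jsym
  have hvol : volume (Ioo (0 : ℝ) 1) < ⊤ := by simp [Real.volume_Ioo]
  have hreal : volume.real (Ioo (0 : ℝ) 1) = 1 := by rw [Real.volume_real_Ioo_of_le zero_le_one]; norm_num
  refine (norm_setIntegral_le_of_norm_le_const (C := 1) hvol fun x hx => ?_).trans (by rw [hreal]; norm_num)
  refine (norm_setIntegral_le_of_norm_le_const (C := 1) hvol fun y hy => ?_).trans (by rw [hreal]; norm_num)
  exact ray_integrand_abs_le_one j n hn hx hy

/-- `rayMult j n ≥ 0`. -/
theorem rayMult_nonneg (j n : ℕ) : (0 : ℚ) ≤ rayMult j n := by unfold rayMult; positivity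

/-- GROWTH REDUCTION: growth `e^{h n}` of the explicit objects `Λ_n Q_n` and `Λ_n` implies `RayGrowth j (h + ε) n₁`
for every `ε > 0` — the implicit `P_n` of the transfer needs no growth input (`|J_n| ≤ 1`, `G < 1`). -/
theorem rayGrowth_of_explicit_growth {j : ℕ} {hq : ℝ} {n₀ : ℕ}
    (hQ : ∀ n : ℕ, n₀ ≤ n → |((rayMult j n : ℚ) : ℝ) * ((rayQ j n : ℚ) : ℝ)| ≤ exp (hq * n))
    (hΛ : ∀ n : ℕ, n₀ ≤ n → ((rayMult j n : ℚ) : ℝ) ≤ exp (hq * n)) {ε : ℝ} (hε : 0 < ε) :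
    ∃ n₁ : ℕ, RayGrowth j (hq + ε) n₁ := by
  obtain ⟨N, hN⟩ : ∃ N : ℕ, 3 ≤ exp (ε * N) := by
    obtain ⟨N, hN⟩ := exists_nat_ge (2 / ε)
    refine ⟨N, ?_⟩
    have h2 : 2 ≤ ε * N := by rw [div_le_iff₀ hε] at hN; linarith
    linarith [Real.add_one_le_exp (ε * N)]
  refine ⟨max (max n₀ 2) N, fun n hn P hP => ?_⟩
  have hn0 : n₀ ≤ n := le_trans (le_trans (le_max_left _ _) (le_max_left _ _)) hn
  have hn2 : 2 ≤ n := le_trans (le_trans (le_max_right _ _) (le_max_left _ _)) hn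
  have hnN : N ≤ n := le_trans (le_max_right _ _) hn
  have hJ := abs_Jsym_ray_le_one j n hn2
  have hG0 := catalanConstant_pos
  have hG1 : catalanConstant ≤ 1 := catalanConstant_lt.le.trans (by norm_num)
  have hΛ0 : (0 : ℝ) ≤ ((rayMult j n : ℚ) : ℝ) := by exact_mod_cast rayMult_nonneg j n
  set Λ : ℝ := ((rayMult j n : ℚ) : ℝ) with hΛdef
  set Q : ℝ := ((rayQ j n : ℚ) : ℝ) with hQdef
  set Jn : ℝ := Jsym n (j * n) n ((j + 1) * n) n with hJdef
  have hPeq : (P : ℝ) = Jn - Q * catalanConstant := by linarith [hP]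
  have hA : |Λ * Q| ≤ exp (hq * n) := hQ n hn0
  have hB : |Λ * (P : ℝ)| ≤ Λ + |Λ * Q| := by
    rw [hPeq]
    calc |Λ * (Jn - Q * catalanConstant)| = |Λ * Jn - Λ * Q * catalanConstant| := by ring_nf
      _ ≤ |Λ * Jn| + |Λ * Q * catalanConstant| := abs_sub _ _
      _ = Λ * |Jn| + |Λ * Q| * catalanConstant := by
          rw [abs_mul, abs_mul (Λ * Q), abs_of_nonneg hΛ0, abs_of_pos hG0]
      _ ≤ Λ * 1 + |Λ * Q| * 1 :=
          add_le_add (mul_le_mul_of_nonneg_left hJ hΛ0) (mul_le_mul_of_nonneg_left hG1 (abs_nonneg _))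
      _ = Λ + |Λ * Q| := by ring
  have hexp : exp ((hq + ε) * n) = exp (hq * n) * exp (ε * n) := by rw [← Real.exp_add]; ring_nf
  have hεn : 3 ≤ exp (ε * n) := by
    refine hN.trans (Real.exp_le_exp.mpr ?_)
    have : (N : ℝ) ≤ n := by exact_mod_cast hnN
    nlinarith [hε.le]
  have hpos := Real.exp_pos (hq * n)
  push_cast
  rw [← hΛdef, ← hQdef]
  calc |Λ * Q| + |Λ * (P : ℝ)| ≤ |Λ * Q| + (Λ + |Λ * Q|) := by linarith
    _ ≤ 3 * exp (hq * n) := by linarith [hΛ n hn0]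
    _ ≤ exp (hq * n) * exp (ε * n) := by nlinarith
    _ = exp ((hq + ε) * n) := hexp.symm

/-- THE RAY MEASURE from explicit inputs only: transfer (K5a) ∧ `P`-integrality (CATK6) ∧ growth of `Λ_n Q_n` and `Λ_n`. -/
theorem ray_measure_explicit (hT : TwoAdicTransfer) {j : ℕ} (hj : 1 ≤ j) (hI : RayIntegrality j)
    {hq : ℝ} {n₀ : ℕ}
    (hQ : ∀ n : ℕ, n₀ ≤ n → |((rayMult j n : ℚ) : ℝ) * ((rayQ j n : ℚ) : ℝ)| ≤ exp (hq * n))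
    (hΛ : ∀ n : ℕ, n₀ ≤ n → ((rayMult j n : ℚ) : ℝ) ≤ exp (hq * n)) (hq0 : 0 ≤ hq)
    {τ τ' : ℝ} (hτ1 : hq < τ) (hτ2 : τ < 4 * (2 * j + 1) * log 2) (hτ' : 4 * (2 * j + 1) * log 2 < τ') :
    ∃ C : ℝ, 0 < C ∧ ∃ κ : ℝ, κ < τ' / (τ - hq) + 1 ∧ ∀ r : ℚ,
      C * (max (r.num.natAbs : ℝ) r.den) ^ (-κ) ≤ ‖xi - ((r : ℚ) : ℚ_[2])‖ := by
  -- take ε with hq + ε < τ and the exponent within 1 of the nominal one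
  set K : ℝ := τ' with hK
  have hK0 : 0 < K := by
    have hl : (0 : ℝ) < 4 * (2 * j + 1) * log 2 := by have := log_pos one_lt_two; positivity
    linarith
  have hgap : 0 < τ - hq := by linarith
  -- ε := min ((τ - hq)/2) (δ) where K/(τ-hq-ε) < K/(τ-hq) + 1  ⇐  ε ≤ (τ-hq)^2/(2K) (and ε ≤ (τ-hq)/2)
  set ε : ℝ := min ((τ - hq) / 2) ((τ - hq) ^ 2 / (2 * (K + 1))) with hεdef
  have hε0 : 0 < ε := by rw [hεdef]; positivity
  have hε1 : ε ≤ (τ - hq) / 2 := min_le_left _ _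
  have hε2 : ε ≤ (τ - hq) ^ 2 / (2 * (K + 1)) := min_le_right _ _
  obtain ⟨n₁, hG⟩ := rayGrowth_of_explicit_growth hQ hΛ hε0
  have hg0 : 0 ≤ hq + ε := by linarith
  have hτ1' : hq + ε < τ := by linarith
  obtain ⟨n₂, hmain⟩ := ray_measure hT hj hI hG hg0 hτ1' hτ2 hτ'
  refine ⟨exp (-(K * (n₂ + 1))), Real.exp_pos _, K / (τ - (hq + ε)), ?_, fun r => hmain r⟩
  -- K/(τ-hq-ε) < K/(τ-hq) + 1
  have hd : 0 < τ - (hq + ε) := by linarith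
  rw [div_lt_iff₀ hd]
  have h1 : K / (τ - hq) * (τ - (hq + ε)) = K - K * ε / (τ - hq) := by field_simp; (try ring)
  -- K < (K/(τ-hq) + 1)(τ - hq - ε) = K - Kε/(τ-hq) + (τ-hq) - ε  ⇔  Kε/(τ-hq) + ε < τ - hq
  have h2 : K * ε / (τ - hq) + ε < τ - hq := by
    have h3 : K * ε / (τ - hq) + ε = ε * (K + (τ - hq)) / (τ - hq) := by field_simp
    rw [h3, div_lt_iff₀ hgap]
    -- ε (K + τ - hq) < (τ-hq)^2, using ε ≤ (τ-hq)^2/(2(K+1)) and ε ≤ (τ-hq)/2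
    have h4 : ε * K < (τ - hq) ^ 2 / 2 := by
      have : ε * (K + 1) ≤ (τ - hq) ^ 2 / 2 := by
        rw [le_div_iff₀ (by positivity : (0:ℝ) < 2 * (K + 1))] at hε2; nlinarith
      nlinarith
    have h5 : ε * (τ - hq) ≤ (τ - hq) ^ 2 / 2 := by nlinarith
    have h6 : ε * (K + (τ - hq)) = ε * K + ε * (τ - hq) := by ring
    have h7 : (τ - hq) ^ 2 = (τ - hq) * (τ - hq) := by ring
    rw [h6]; nlinarith
  nlinarith [h1, h2]

end Growth

section Window

/-- A window multiplier: an odd integer sequence times `2^{2Wn}`, `W = 2j+1`. -/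
def winMult (D : ℕ → ℕ) (j n : ℕ) : ℚ := ((D n : ℕ) : ℚ) * 2 ^ (2 * (2 * j + 1) * n)

/-- a window multiplier with odd `D n` is non-zero. -/
theorem winMult_ne_zero {D : ℕ → ℕ} (hD : ∀ n, Odd (D n)) (j n : ℕ) : winMult D j n ≠ 0 := by
  unfold winMult
  refine mul_ne_zero ?_ (pow_ne_zero _ two_ne_zero)
  exact_mod_cast (hD n).pos.ne'

/-- `v₂` of a window multiplier with odd `D n` is `2Wn`. -/
theorem padicValRat_two_winMult {D : ℕ → ℕ} (hD : ∀ n, Odd (D n)) (j n : ℕ) :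
    padicValRat 2 (winMult D j n) = (2 * (2 * j + 1) * n : ℕ) := by
  unfold winMult
  have hodd : ¬ 2 ∣ D n := by obtain ⟨k, hk⟩ := hD n; omega
  have hne : ((D n : ℕ) : ℚ) ≠ 0 := by exact_mod_cast (hD n).pos.ne'
  rw [padicValRat.mul hne (pow_ne_zero _ two_ne_zero), padicValRat.pow (2 : ℚ),
    padicValRat.of_nat, padicValNat.eq_zero_of_not_dvd hodd]
  have h2 : padicValRat 2 (2 : ℚ) = 1 := by simpa using padicValRat.self (p := 2) one_lt_two
  rw [h2]; push_cast; ring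

/-- HYPOTHESIS SCHEMA (window integrality; paper: CATK6 + K7): `D_n 2^{2Wn}` clears `Q_n` and the transfer's `P_n`. -/
@[conjecture] def WinIntegrality (D : ℕ → ℕ) (j : ℕ) : Prop :=
  ∀ n : ℕ, 1 ≤ n → ∀ P : ℚ, Jsym n (j * n) n ((j + 1) * n) n = (rayQ j n : ℝ) * catalanConstant + (P : ℝ) →
    (∃ z : ℤ, (z : ℚ) = winMult D j n * rayQ j n) ∧ (∃ z : ℤ, (z : ℚ) = winMult D j n * P)

/-- HYPOTHESIS SCHEMA (window growth): `|D_n 2^{2Wn} Q_n| + |D_n 2^{2Wn} P_n| ≤ e^{h n}`, `n ≥ n₀` (`h = b_j + 2W log 2 + T_j + ε`). -/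
@[conjecture] def WinGrowth (D : ℕ → ℕ) (j : ℕ) (hg : ℝ) (n₀ : ℕ) : Prop :=
  ∀ n : ℕ, n₀ ≤ n → ∀ P : ℚ, Jsym n (j * n) n ((j + 1) * n) n = (rayQ j n : ℝ) * catalanConstant + (P : ℝ) →
    ((|winMult D j n * rayQ j n| + |winMult D j n * P| : ℚ) : ℝ) ≤ exp (hg * n)

/-- **The window chain, assembled**: for any odd clearing sequence `D`, transfer + window integrality + growth `h`
give `‖ξ − u/v‖₂ ≥ C · max(|u|,v)^{−τ'/(τ − h)}` for all `h < τ < 4W log 2 < τ'`. -/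
theorem window_measure (hT : TwoAdicTransfer) {D : ℕ → ℕ} (hD : ∀ n, Odd (D n)) {j : ℕ} (hj : 1 ≤ j)
    (hI : WinIntegrality D j)
    {hg : ℝ} {n₀ : ℕ} (hG : WinGrowth D j hg n₀) (hg0 : 0 ≤ hg) {τ τ' : ℝ} (hτ1 : hg < τ)
    (hτ2 : τ < 4 * (2 * j + 1) * log 2) (hτ' : 4 * (2 * j + 1) * log 2 < τ') :
    ∃ n₁ : ℕ, ∀ r : ℚ,
      exp (-(τ' * (n₁ + 1))) * (max (r.num.natAbs : ℝ) r.den) ^ (-(τ' / (τ - hg)))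
        ≤ ‖xi - ((r : ℚ) : ℚ_[2])‖ := by
  -- abbreviations
  set W : ℕ := 2 * j + 1 with hW
  have hW1 : (1 : ℝ) ≤ W := by rw [hW]; push_cast; linarith [(show (1:ℝ) ≤ j by exact_mod_cast hj)]
  -- box conditions on the ray, for n ≥ 1
  have box : ∀ n : ℕ, 1 ≤ n →
      n ≤ n + (j + 1) * n ∧ j * n ≤ (j + 1) * n + n ∧ n ≤ n + n ∧ (j + 1) * n ≤ n + j * n ∧
        n + 1 ≤ j * n + n := by
    intro n hn
    refine ⟨by omega, by nlinarith, by omega, by nlinarith, ?_⟩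
    have : 1 ≤ j * n := Nat.one_le_iff_ne_zero.mpr (Nat.mul_ne_zero (by omega) (by omega))
    omega
  -- the transfer data P_n (defined for all n, meaningful for n ≥ 1)
  have hP : ∀ n : ℕ, ∃ P : ℚ, 1 ≤ n →
      Jsym n (j * n) n ((j + 1) * n) n = (rayQ j n : ℝ) * catalanConstant + (P : ℝ) ∧
        J2 n (j * n) n ((j + 1) * n) n = ((P : ℚ) : ℚ_[2]) + xi * ((rayQ j n : ℚ) : ℚ_[2]) := by
    intro n
    by_cases hn : 1 ≤ n
    · obtain ⟨h1, h2, h3, h4, h5⟩ := box n hn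
      obtain ⟨P, hP1, hP2⟩ := hT n (j * n) n ((j + 1) * n) n h1 h2 h3 h4 h5
      exact ⟨P, fun _ => ⟨hP1, hP2⟩⟩
    · exact ⟨0, fun h => absurd h hn⟩
  choose P hP using hP
  -- integer witnesses
  have hA : ∀ n : ℕ, ∃ z : ℤ, 1 ≤ n → (z : ℚ) = winMult D j n * rayQ j n := by
    intro n
    by_cases hn : 1 ≤ n
    · obtain ⟨z, hz⟩ := (hI n hn (P n) (hP n hn).1).1; exact ⟨z, fun _ => hz⟩
    · exact ⟨0, fun h => absurd h hn⟩
  have hB : ∀ n : ℕ, ∃ z : ℤ, 1 ≤ n → (z : ℚ) = winMult D j n * P n := by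
    intro n
    by_cases hn : 1 ≤ n
    · obtain ⟨z, hz⟩ := (hI n hn (P n) (hP n hn).1).2; exact ⟨z, fun _ => hz⟩
    · exact ⟨0, fun h => absurd h hn⟩
  choose a ha using hA
  choose b hb using hB
  -- the form equals Λ_n · J2_n in ℚ₂, hence its exact norm
  have hform : ∀ n : ℕ, 1 ≤ n →
      (a n : ℚ_[2]) * xi + b n = ((winMult D j n : ℚ) : ℚ_[2]) * J2 n (j * n) n ((j + 1) * n) n := by
    intro n hn
    have e1 : (a n : ℚ_[2]) = ((winMult D j n * rayQ j n : ℚ) : ℚ_[2]) := by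
      rw [← ha n hn, Rat.cast_intCast]
    have e2 : (b n : ℚ_[2]) = ((winMult D j n * P n : ℚ) : ℚ_[2]) := by
      rw [← hb n hn, Rat.cast_intCast]
    rw [e1, e2, (hP n hn).2]; push_cast; ring
  have hnorm : ∀ n : ℕ, 1 ≤ n →
      ‖(a n : ℚ_[2]) * xi + b n‖
        = (2 : ℝ) ^ (-(4 * (2 * j + 1) * (n : ℤ) + 2 - ((Nat.digits 2 (j * n)).sum : ℤ)
              - ((Nat.digits 2 ((j + 1) * n)).sum : ℤ))) := by
    intro n hn
    rw [hform n hn, norm_mul, norm_ratCast_eq _ (winMult_ne_zero hD j n), padicValRat_two_winMult hD, norm_J2,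
      ← zpow_add₀ (by norm_num : (2 : ℝ) ≠ 0)]
    congr 1
    have := rayExponent_eq j n
    push_cast at this ⊢
    linarith
  -- the index threshold: δ = 4W log 2 − τ > 0, and n ≥ N ⇒ j(j+1) n² < e^{δ n}
  set δ : ℝ := 4 * (2 * j + 1) * log 2 - τ with hδ
  have hδ0 : 0 < δ := by rw [hδ]; linarith
  obtain ⟨N, hN⟩ := exists_nat_gt (6 * ((j : ℝ) * (j + 1)) / δ ^ 3)
  obtain ⟨N', hN'⟩ := exists_nat_gt (2 * log 2 / (τ' - 4 * (2 * j + 1) * log 2))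
  refine ⟨max (max (max n₀ 1) N) N', ?_⟩
  set n₁ : ℕ := max (max (max n₀ 1) N) N' with hn₁
  have hn₁0 : n₀ ≤ n₁ := le_trans (le_trans (le_max_left _ _) (le_max_left _ _)) (le_max_left _ _)
  have hn₁1 : 1 ≤ n₁ := le_trans (le_trans (le_max_right _ _) (le_max_left _ _)) (le_max_left _ _)
  have hn₁N : N ≤ n₁ := le_trans (le_max_right _ _) (le_max_left _ _)
  have hn₁N' : N' ≤ n₁ := le_max_right _ _
  have hlog2 : (0 : ℝ) < log 2 := log_pos one_lt_two
  -- apply the general measure theorem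
  have key := measure_of_two_sided_forms (p := 2) xi a b (h := hg) (τ := τ)
    (τ' := τ') (n₀ := n₁) hg0 hτ1 (by linarith) ?_ ?_ ?_
  · intro r
    exact key r
  · -- growth
    intro n hn
    have hn0 : n₀ ≤ n := hn₁0.trans hn
    have hn1 : 1 ≤ n := hn₁1.trans hn
    have hg' := hG n hn0 (P n) (hP n hn1).1
    have e1 : ((a n).natAbs : ℝ) = |((winMult D j n * rayQ j n : ℚ) : ℝ)| := by
      rw [Nat.cast_natAbs, Int.cast_abs, ← ha n hn1, Rat.cast_intCast]
    have e2 : ((b n).natAbs : ℝ) = |((winMult D j n * P n : ℚ) : ℝ)| := by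
      rw [Nat.cast_natAbs, Int.cast_abs, ← hb n hn1, Rat.cast_intCast]
    rw [e1, e2]
    push_cast at hg' ⊢
    exact hg'
  · -- upper bound: exact norm < e^{-τ n}
    intro n hn
    have hn1 : 1 ≤ n := hn₁1.trans hn
    have hnN : N ≤ n := hn₁N.trans hn
    rw [hnorm n hn1]
    -- 2^{-(4Wn+2)+s+s'} ≤ 2^{-4Wn} · j(j+1) n²
    have hs1 := two_pow_digitSum_le (j * n) (Nat.mul_ne_zero (by omega) (by omega))
    have hs2 := two_pow_digitSum_le ((j + 1) * n) (Nat.mul_ne_zero (by omega) (by omega))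
    have hs1' : (2 : ℝ) ^ ((Nat.digits 2 (j * n)).sum : ℤ) ≤ 2 * ((j : ℝ) * n) := by
      rw [zpow_natCast]; exact_mod_cast hs1
    have hs2' : (2 : ℝ) ^ ((Nat.digits 2 ((j + 1) * n)).sum : ℤ) ≤ 2 * (((j : ℝ) + 1) * n) := by
      rw [zpow_natCast]; exact_mod_cast hs2
    have hsplit : (2 : ℝ) ^ (-(4 * (2 * j + 1) * (n : ℤ) + 2 - ((Nat.digits 2 (j * n)).sum : ℤ)
              - ((Nat.digits 2 ((j + 1) * n)).sum : ℤ)))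
          = (2 : ℝ) ^ (-(4 * (2 * j + 1) * (n : ℤ))) * (1 / 4) *
              ((2 : ℝ) ^ ((Nat.digits 2 (j * n)).sum : ℤ) * (2 : ℝ) ^ ((Nat.digits 2 ((j + 1) * n)).sum : ℤ)) := by
      rw [show -(4 * (2 * j + 1) * (n : ℤ) + 2 - ((Nat.digits 2 (j * n)).sum : ℤ)
              - ((Nat.digits 2 ((j + 1) * n)).sum : ℤ))
            = -(4 * (2 * j + 1) * (n : ℤ)) + (-2) + (((Nat.digits 2 (j * n)).sum : ℤ)
              + ((Nat.digits 2 ((j + 1) * n)).sum : ℤ)) by ring,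
        zpow_add₀ (by norm_num : (2:ℝ) ≠ 0), zpow_add₀ (by norm_num : (2:ℝ) ≠ 0),
        zpow_add₀ (by norm_num : (2:ℝ) ≠ 0)]
      norm_num
    have hpow_pos : (0 : ℝ) < (2 : ℝ) ^ (-(4 * (2 * j + 1) * (n : ℤ))) := zpow_pos (by norm_num) _
    have hup1 : (2 : ℝ) ^ (-(4 * (2 * j + 1) * (n : ℤ) + 2 - ((Nat.digits 2 (j * n)).sum : ℤ)
              - ((Nat.digits 2 ((j + 1) * n)).sum : ℤ)))
          ≤ (2 : ℝ) ^ (-(4 * (2 * j + 1) * (n : ℤ))) * (((j : ℝ) * (j + 1)) * (n : ℝ) ^ 2) := by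
      rw [hsplit, mul_assoc]
      refine mul_le_mul_of_nonneg_left ?_ hpow_pos.le
      have h1 : (0:ℝ) ≤ (2 : ℝ) ^ ((Nat.digits 2 (j * n)).sum : ℤ) := zpow_nonneg (by norm_num) _
      have h2 : (0:ℝ) ≤ 2 * (((j : ℝ) + 1) * n) := by positivity
      calc (1 / 4 : ℝ) * ((2 : ℝ) ^ ((Nat.digits 2 (j * n)).sum : ℤ) * (2 : ℝ) ^ ((Nat.digits 2 ((j + 1) * n)).sum : ℤ))
          ≤ (1 / 4) * ((2 * ((j : ℝ) * n)) * (2 * (((j : ℝ) + 1) * n))) := by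
            gcongr
        _ = ((j : ℝ) * (j + 1)) * (n : ℝ) ^ 2 := by ring
    -- 2^{-4Wn} = e^{-4W log2 n} and j(j+1)n² < e^{δ n}
    have h2pow : (2 : ℝ) ^ (-(4 * (2 * j + 1) * (n : ℤ))) = exp (-(4 * (2 * j + 1) * log 2 * n)) := by
      rw [← rpow_intCast, rpow_def_of_pos (by norm_num : (0:ℝ) < 2)]; congr 1; push_cast; ring
    have hNn : 6 * ((j : ℝ) * (j + 1)) / δ ^ 3 < n := by
      calc 6 * ((j : ℝ) * (j + 1)) / δ ^ 3 < (N : ℝ) := hN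
        _ ≤ n := by exact_mod_cast hnN
    have hpoly : ((j : ℝ) * (j + 1)) * (n : ℝ) ^ 2 < exp (δ * n) := by
      have hδn : 0 ≤ δ * n := by positivity
      have h3 := pow_div_factorial_le_exp (x := δ * n) hδn 3
      have hn' : (0 : ℝ) < n := by exact_mod_cast (show 0 < n by omega)
      have : ((j : ℝ) * (j + 1)) * (n : ℝ) ^ 2 < (δ * n) ^ 3 / (Nat.factorial 3) := by
        rw [show (Nat.factorial 3 : ℝ) = 6 by norm_num, lt_div_iff₀ (by norm_num : (0:ℝ) < 6)]
        have hδ3 : 0 < δ ^ 3 := by positivity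
        have h5 := (div_lt_iff₀ hδ3).mp hNn
        have h4 : 6 * ((j : ℝ) * (j + 1)) * (n : ℝ) ^ 2 < (n : ℝ) * δ ^ 3 * (n : ℝ) ^ 2 :=
          mul_lt_mul_of_pos_right h5 (by positivity)
        calc (j : ℝ) * (j + 1) * (n : ℝ) ^ 2 * 6 = 6 * ((j : ℝ) * (j + 1)) * (n : ℝ) ^ 2 := by ring
          _ < (n : ℝ) * δ ^ 3 * (n : ℝ) ^ 2 := h4
          _ = (δ * n) ^ 3 := by ring
      exact this.trans_le h3
    calc (2 : ℝ) ^ (-(4 * (2 * j + 1) * (n : ℤ) + 2 - ((Nat.digits 2 (j * n)).sum : ℤ)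
              - ((Nat.digits 2 ((j + 1) * n)).sum : ℤ)))
        ≤ (2 : ℝ) ^ (-(4 * (2 * j + 1) * (n : ℤ))) * (((j : ℝ) * (j + 1)) * (n : ℝ) ^ 2) := hup1
      _ < exp (-(4 * (2 * j + 1) * log 2 * n)) * exp (δ * n) := by rw [h2pow]; gcongr
      _ = exp (-(τ * n)) := by rw [← exp_add]; congr 1; rw [hδ]; ring
  · -- lower bound: exact norm ≥ 2^{-(4Wn+2)} ≥ e^{-τ' n} as soon as (τ' − 4W log 2)·n ≥ 2 log 2
    intro n hn
    have hn1 : 1 ≤ n := hn₁1.trans hn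
    have hnN' : N' ≤ n := hn₁N'.trans hn
    rw [hnorm n hn1]
    have hgap' : 0 < τ' - 4 * (2 * j + 1) * log 2 := by linarith
    have hnr : 2 * log 2 / (τ' - 4 * (2 * j + 1) * log 2) < n :=
      hN'.trans_le (by exact_mod_cast hnN')
    have hlin : 4 * (2 * j + 1) * log 2 * n + 2 * log 2 ≤ τ' * n := by
      have := (div_lt_iff₀ hgap').mp hnr
      nlinarith
    calc exp (-(τ' * n)) ≤ exp (-(4 * (2 * j + 1) * log 2 * n + 2 * log 2)) := exp_le_exp.mpr (by linarith)
      _ = (2 : ℝ) ^ (-(4 * (2 * j + 1) * (n : ℤ)) - 2) := by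
          rw [← rpow_intCast, rpow_def_of_pos (by norm_num : (0:ℝ) < 2)]; congr 1; push_cast; ring
      _ ≤ (2 : ℝ) ^ (-(4 * (2 * j + 1) * (n : ℤ) + 2 - ((Nat.digits 2 (j * n)).sum : ℤ)
              - ((Nat.digits 2 ((j + 1) * n)).sum : ℤ))) := by
          apply zpow_le_zpow_right₀ (by norm_num : (1:ℝ) ≤ 2)
          have h1 : (0 : ℤ) ≤ ((Nat.digits 2 (j * n)).sum : ℤ) := by positivity
          have h2 : (0 : ℤ) ≤ ((Nat.digits 2 ((j + 1) * n)).sum : ℤ) := by positivity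
          linarith

end Window

end Summit.KontsevichZagierPeriods.Zeta5Search.CatalanTwoAdicSeries
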